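import Mathlib
import HarnessLib
import Summits.KontsevichZagierPeriods.KontsevichZagierPeriods.Theses.LinRedNormalForm
import Summits.KontsevichZagierPeriods.KontsevichZagierPeriods.Theorems.LinRedNormalFormDihedralNormalFormStubNestedReductionAux3

/-!
# `DihedralNormalForm`, line `torus-descent-sum-shadow`, stub `stub_nestedReduction` — Aux 4

Support file for the stub `stub_nestedReduction` (THEOREM N) of the crux `DihedralNormalForm`
(stmt-KontsevichZagierPeriods-3912, route `LinRedNormalForm`): **the stub in dimension `≤ 2`**
(`stub_nestedReduction_le_two`, registered), where the nestedness hypothesis is vacuous.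

* Necessity of the convergence criterion at `k = 2` by disjoint dyadic boxes
  (`Nested.no_uniform_boxes` of Aux 3: a nonnegative integrable function cannot carry mass
  `≥ C > 0` on infinitely many pairwise disjoint pieces), applied at the faces `x₁ = 1`, `x₀ = 1` and the
  corner `(1,1)`: a convergent atom `q·x₀^{a₀}x₁^{a₁}(1−x₀)^{e₀₀}(1−x₀x₁)^{e₀₁}(1−x₁)^{e₁₁}`,
  `q ≠ 0`, has `e₀₀ ≥ 0`, `e₁₁ ≥ 0`, `e₀₁ ≥ −(e₀₀ + e₁₁ + 1)` (`Nested.necessity_two`).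
* `Nested.nested_two`: such an atom is a multi-term 1b combination of the representations
  `Nested.rep2` of Aux 2/3 (a binomial expansion of a numerator kernel `(1−x₀x₁)^C`, or the
  representation itself), which reduce by `Nested.rep2_red`.

References: M. Kontsevich, D. Zagier, *Periods* (2001), §1.2, rules (1)–(3).
-/

noncomputable section

open MeasureTheory Set

namespace Summit.KontsevichZagierPeriods.DihedralNormalForm.TorusDescent

open Literature.NumberTheory.Transcendental

namespace Nested

/-! ### Necessity of the convergence criterion at `k = 2`: disjoint dyadic boxes

If `f ≥ 0` is integrable on the square, there cannot be infinitely many pairwise disjoint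
measurable pieces each carrying mass `≥ C > 0` (`no_uniform_boxes`, Aux 3).  Applied to dyadic
boxes accumulating at the face `x₁ = 1` (resp. `x₀ = 1`, resp. the corner `(1,1)`) this gives
`e₁₁ ≥ 0` (resp. `e₀₀ ≥ 0`, resp. `−e₀₁ ≤ e₀₀ + e₁₁ + 1`) for every convergent atom of dimension `2`. -/

/-- Open boxes in the square. -/
def box2 (l0 u0 l1 u1 : ℝ) : Set (Fin 2 → ℝ) := {x | x 0 ∈ Ioo l0 u0 ∧ x 1 ∈ Ioo l1 u1}

/-- A box as a product set. -/
theorem box2_eq_pi (l0 u0 l1 u1 : ℝ) :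
    box2 l0 u0 l1 u1 = Set.pi univ (fun i => Ioo ((![l0, l1] : Fin 2 → ℝ) i) ((![u0, u1] : Fin 2 → ℝ) i)) := by
  ext x
  simp [box2, Fin.forall_fin_two]

/-- Boxes are measurable. -/
theorem measurableSet_box2 (l0 u0 l1 u1 : ℝ) : MeasurableSet (box2 l0 u0 l1 u1) := by
  rw [box2_eq_pi]; exact MeasurableSet.univ_pi fun _ => measurableSet_Ioo

/-- The area of a box. -/
theorem volume_real_box2 {l0 u0 l1 u1 : ℝ} (h0 : l0 ≤ u0) (h1 : l1 ≤ u1) :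
    volume.real (box2 l0 u0 l1 u1) = (u0 - l0) * (u1 - l1) := by
  rw [measureReal_def, box2_eq_pi, volume_pi_pi]
  simp [Fin.prod_univ_two, Real.volume_Ioo, ENNReal.toReal_ofReal, h0, h1, sub_nonneg]

/-- The dyadic scale `δ_j = 4^{-(j+1)}`. -/
def dy (j : ℕ) : ℝ := (1 / 4) ^ (j + 1)

/-- Basic facts on the dyadic scale. -/
theorem dy_facts (j : ℕ) : 0 < dy j ∧ dy j ≤ 1 / 4 ∧ dy j ≤ 1 := by
  refine ⟨by unfold dy; positivity, ?_, ?_⟩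
  · unfold dy
    calc (1 / 4 : ℝ) ^ (j + 1) ≤ (1 / 4) ^ 1 := pow_le_pow_of_le_one (by norm_num) (by norm_num) (by omega)
      _ = 1 / 4 := pow_one _
  · unfold dy
    exact pow_le_one₀ (by norm_num) (by norm_num)

/-- Separation of consecutive scales: for `j < j'`, `2 δ_{j'} ≤ δ_j / 2`. -/
theorem dy_sep {j j' : ℕ} (h : j < j') : 2 * dy j' ≤ dy j / 2 := by
  have h1 : dy j' ≤ dy (j + 1) := pow_le_pow_of_le_one (by norm_num) (by norm_num) (by omega)
  have h2 : dy (j + 1) = dy j / 4 := by unfold dy; rw [pow_succ]; ring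
  linarith

/-- The dyadic windows `(1 − 2δ_j, 1 − δ_j)` are pairwise disjoint. -/
theorem dy_window_disjoint {j j' : ℕ} (h : j ≠ j') {t : ℝ}
    (ht : t ∈ Ioo (1 - 2 * dy j) (1 - dy j)) (ht' : t ∈ Ioo (1 - 2 * dy j') (1 - dy j')) : False := by
  rcases lt_or_gt_of_ne h with hlt | hlt
  · have := dy_sep hlt
    have := (dy_facts j).1
    linarith [ht.2, ht'.1]
  · have := dy_sep hlt
    have := (dy_facts j').1
    linarith [ht'.2, ht.1]

/-- Lower bound for powers of a quantity in `[½, 1]`: `(½)^{|b|} ≤ y^b` for every integer `b`. -/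
theorem half_zpow_le {y : ℝ} (hy : 1 / 2 ≤ y) (hy1 : y ≤ 1) (b : ℤ) :
    (1 / 2 : ℝ) ^ b.natAbs ≤ y ^ b := by
  have hy0 : 0 < y := by linarith
  rcases le_or_gt 0 b with hb | hb
  · obtain ⟨n, rfl⟩ := Int.eq_ofNat_of_zero_le hb
    rw [Int.natAbs_natCast, zpow_natCast]
    exact pow_le_pow_left₀ (by norm_num) hy n
  · calc (1 / 2 : ℝ) ^ b.natAbs ≤ 1 := pow_le_one₀ (by norm_num) (by norm_num)
      _ ≤ y ^ b := one_le_zpow_of_nonpos₀ hy0 hy1 hb.le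

/-- The five-factor shape of a `k = 2` atom integrand (without the coefficient). -/
def f5 (a0 a1 : ℕ) (b0 c b1 : ℤ) (x : Fin 2 → ℝ) : ℝ :=
  x 0 ^ a0 * x 1 ^ a1 * ((1 - x 0) ^ b0 * (1 - x 0 * x 1) ^ c * (1 - x 1) ^ b1)

/-- `f5` is nonnegative on the open square. -/
theorem f5_nonneg (a0 a1 : ℕ) (b0 c b1 : ℤ) {x : Fin 2 → ℝ} (hx : x ∈ ocube 2) :
    0 ≤ f5 a0 a1 b0 c b1 x := by
  obtain ⟨h0, h0', h1, h1', hu, -⟩ := two_facts hx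
  unfold f5
  exact mul_nonneg (mul_nonneg (pow_nonneg h0.le _) (pow_nonneg h1.le _))
    (mul_nonneg (mul_nonneg (zpow_nonneg (by linarith) _) (zpow_nonneg hu.le _))
      (zpow_nonneg (by linarith) _))

/-- `f5` is measurable. -/
theorem measurable_f5 (a0 a1 : ℕ) (b0 c b1 : ℤ) : Measurable (f5 a0 a1 b0 c b1) := by
  unfold f5; fun_prop

/-- A box inside the square, its finiteness and the integral lower bound from a pointwise one. -/
theorem box_integral_ge {f : (Fin 2 → ℝ) → ℝ} (hf : IntegrableOn f (ocube 2)) {l0 u0 l1 u1 K : ℝ}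
    (hsub : box2 l0 u0 l1 u1 ⊆ ocube 2) (h0 : l0 ≤ u0) (h1 : l1 ≤ u1)
    (hK : ∀ x ∈ box2 l0 u0 l1 u1, K ≤ f x) :
    K * ((u0 - l0) * (u1 - l1)) ≤ ∫ x in box2 l0 u0 l1 u1, f x := by
  rw [← volume_real_box2 h0 h1]
  refine setIntegral_ge_of_const_le_real (measurableSet_box2 _ _ _ _) ?_ hK (hf.mono_set hsub)
  exact ((measure_mono hsub).trans_lt (by rw [volume_ocube]; exact ENNReal.one_lt_top)).ne

/-- Boxes with both windows inside `(0,1)` lie in the open square. -/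
theorem box2_subset_ocube {l0 u0 l1 u1 : ℝ} (hl0 : 0 ≤ l0) (hu0 : u0 ≤ 1) (hl1 : 0 ≤ l1)
    (hu1 : u1 ≤ 1) : box2 l0 u0 l1 u1 ⊆ ocube 2 := by
  intro x hx i
  fin_cases i
  · exact ⟨hl0.trans_lt hx.1.1, hx.1.2.trans_le hu0⟩
  · exact ⟨hl1.trans_lt hx.2.1, hx.2.2.trans_le hu1⟩

/-- **Face `x₁ = 1`**: a convergent atom has `e₁₁ ≥ 0`. -/
theorem nec_b1 (a0 a1 : ℕ) (b0 c b1 : ℤ) (hf : IntegrableOn (f5 a0 a1 b0 c b1) (ocube 2)) :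
    0 ≤ b1 := by
  by_contra hneg
  have hb1 : b1 ≤ -1 := by omega
  set K : ℝ := (1 / 4) ^ a0 * (1 / 2) ^ a1 * ((1 / 2) ^ b0.natAbs * (1 / 2) ^ c.natAbs) with hK
  have hKpos : 0 < K := by positivity
  refine no_uniform_boxes hf (fun x hx => f5_nonneg a0 a1 b0 c b1 hx)
    (fun j => box2 (1 / 4) (1 / 2) (1 - 2 * dy j) (1 - dy j)) (fun j => measurableSet_box2 _ _ _ _)
    (fun j => box2_subset_ocube (by norm_num) (by norm_num) (by linarith [(dy_facts j).2.1])
      (by linarith [(dy_facts j).1]))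
    (fun j j' hjj' => Set.disjoint_left.mpr fun x hx hx' => dy_window_disjoint hjj' hx.2 hx'.2)
    (C := K / 8) (by positivity) fun j => ?_
  obtain ⟨hδ, hδ4, hδ1⟩ := dy_facts j
  have hlow : ∀ x ∈ box2 (1 / 4) (1 / 2) (1 - 2 * dy j) (1 - dy j), K / (2 * dy j) ≤ f5 a0 a1 b0 c b1 x := by
    intro x hx
    obtain ⟨⟨hx0, hx0'⟩, ⟨hx1, hx1'⟩⟩ := hx
    have e1 : (1 / 4 : ℝ) ^ a0 ≤ x 0 ^ a0 := pow_le_pow_left₀ (by norm_num) hx0.le a0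
    have e2 : (1 / 2 : ℝ) ^ a1 ≤ x 1 ^ a1 := pow_le_pow_left₀ (by norm_num) (by linarith) a1
    have e3 : (1 / 2 : ℝ) ^ b0.natAbs ≤ (1 - x 0) ^ b0 := half_zpow_le (by linarith) (by linarith) b0
    have e4 : (1 / 2 : ℝ) ^ c.natAbs ≤ (1 - x 0 * x 1) ^ c := by
      refine half_zpow_le ?_ ?_ c
      · nlinarith
      · nlinarith
    have h1x : 0 < 1 - x 1 := by linarith
    have e5 : 1 / (2 * dy j) ≤ (1 - x 1) ^ b1 := by
      calc 1 / (2 * dy j) ≤ 1 / (1 - x 1) := one_div_le_one_div_of_le h1x (by linarith)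
        _ = (1 - x 1) ^ (-1 : ℤ) := by rw [zpow_neg_one, one_div]
        _ ≤ (1 - x 1) ^ b1 := zpow_le_zpow_right_of_le_one₀ h1x (by linarith) hb1
    calc K / (2 * dy j) = (1 / 4) ^ a0 * (1 / 2) ^ a1 *
        ((1 / 2) ^ b0.natAbs * (1 / 2) ^ c.natAbs * (1 / (2 * dy j))) := by rw [hK]; ring
      _ ≤ f5 a0 a1 b0 c b1 x := by
        unfold f5
        have hu0 : 0 ≤ 1 - x 0 * x 1 := by nlinarith
        exact mul_le_mul (mul_le_mul e1 e2 (by positivity) (pow_nonneg (by linarith) _))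
          (mul_le_mul (mul_le_mul e3 e4 (by positivity) (zpow_nonneg (by linarith) _)) e5
            (by positivity) (mul_nonneg (zpow_nonneg (by linarith) _) (zpow_nonneg hu0 _)))
          (by positivity) (mul_nonneg (pow_nonneg (by linarith) _) (pow_nonneg (by linarith) _))
  have := box_integral_ge hf (box2_subset_ocube (by norm_num) (by norm_num) (by linarith) (by linarith))
    (by norm_num) (by linarith) hlow
  have hvol : K / (2 * dy j) * ((1 / 2 - 1 / 4) * (1 - dy j - (1 - 2 * dy j))) = K / 8 := by
    field_simp
    ring
  linarith

/-- **Face `x₀ = 1`**: a convergent atom has `e₀₀ ≥ 0`. -/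
theorem nec_b0 (a0 a1 : ℕ) (b0 c b1 : ℤ) (hf : IntegrableOn (f5 a0 a1 b0 c b1) (ocube 2)) :
    0 ≤ b0 := by
  by_contra hneg
  have hb0 : b0 ≤ -1 := by omega
  set K : ℝ := (1 / 2) ^ a0 * (1 / 4) ^ a1 * ((1 / 2) ^ c.natAbs * (1 / 2) ^ b1.natAbs) with hK
  have hKpos : 0 < K := by positivity
  refine no_uniform_boxes hf (fun x hx => f5_nonneg a0 a1 b0 c b1 hx)
    (fun j => box2 (1 - 2 * dy j) (1 - dy j) (1 / 4) (1 / 2)) (fun j => measurableSet_box2 _ _ _ _)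
    (fun j => box2_subset_ocube (by linarith [(dy_facts j).2.1]) (by linarith [(dy_facts j).1])
      (by norm_num) (by norm_num))
    (fun j j' hjj' => Set.disjoint_left.mpr fun x hx hx' => dy_window_disjoint hjj' hx.1 hx'.1)
    (C := K / 8) (by positivity) fun j => ?_
  obtain ⟨hδ, hδ4, hδ1⟩ := dy_facts j
  have hlow : ∀ x ∈ box2 (1 - 2 * dy j) (1 - dy j) (1 / 4) (1 / 2), K / (2 * dy j) ≤ f5 a0 a1 b0 c b1 x := by
    intro x hx
    obtain ⟨⟨hx0, hx0'⟩, ⟨hx1, hx1'⟩⟩ := hx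
    have e1 : (1 / 2 : ℝ) ^ a0 ≤ x 0 ^ a0 := pow_le_pow_left₀ (by norm_num) (by linarith) a0
    have e2 : (1 / 4 : ℝ) ^ a1 ≤ x 1 ^ a1 := pow_le_pow_left₀ (by norm_num) hx1.le a1
    have h1x : 0 < 1 - x 0 := by linarith
    have e3 : 1 / (2 * dy j) ≤ (1 - x 0) ^ b0 := by
      calc 1 / (2 * dy j) ≤ 1 / (1 - x 0) := one_div_le_one_div_of_le h1x (by linarith)
        _ = (1 - x 0) ^ (-1 : ℤ) := by rw [zpow_neg_one, one_div]
        _ ≤ (1 - x 0) ^ b0 := zpow_le_zpow_right_of_le_one₀ h1x (by linarith) hb0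
    have e4 : (1 / 2 : ℝ) ^ c.natAbs ≤ (1 - x 0 * x 1) ^ c := by
      refine half_zpow_le ?_ ?_ c
      · nlinarith
      · nlinarith
    have e5 : (1 / 2 : ℝ) ^ b1.natAbs ≤ (1 - x 1) ^ b1 := half_zpow_le (by linarith) (by linarith) b1
    calc K / (2 * dy j) = (1 / 2) ^ a0 * (1 / 4) ^ a1 *
        ((1 / (2 * dy j)) * (1 / 2) ^ c.natAbs * (1 / 2) ^ b1.natAbs) := by rw [hK]; ring
      _ ≤ f5 a0 a1 b0 c b1 x := by
        unfold f5
        have hu0 : 0 ≤ 1 - x 0 * x 1 := by nlinarith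
        exact mul_le_mul (mul_le_mul e1 e2 (by positivity) (pow_nonneg (by linarith) _))
          (mul_le_mul (mul_le_mul e3 e4 (by positivity) (zpow_nonneg h1x.le _)) e5
            (by positivity) (mul_nonneg (zpow_nonneg h1x.le _) (zpow_nonneg hu0 _)))
          (by positivity) (mul_nonneg (pow_nonneg (by linarith) _) (pow_nonneg (by linarith) _))
  have := box_integral_ge hf (box2_subset_ocube (by linarith) (by linarith) (by norm_num) (by norm_num))
    (by linarith) (by norm_num) hlow
  have hvol : K / (2 * dy j) * ((1 - dy j - (1 - 2 * dy j)) * (1 / 2 - 1 / 4)) = K / 8 := by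
    field_simp
    ring
  linarith

/-- **Corner `(1,1)`**: a convergent atom with `e₀₀, e₁₁ ≥ 0` has `−e₀₁ ≤ e₀₀ + e₁₁ + 1`. -/
theorem nec_corner (a0 a1 : ℕ) {b0 c b1 : ℤ} (hb0 : 0 ≤ b0) (hb1 : 0 ≤ b1)
    (hf : IntegrableOn (f5 a0 a1 b0 c b1) (ocube 2)) : -(b0 + b1 + 1) ≤ c := by
  by_contra hneg
  obtain ⟨B0, rfl⟩ := Int.eq_ofNat_of_zero_le hb0
  obtain ⟨B1, rfl⟩ := Int.eq_ofNat_of_zero_le hb1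
  obtain ⟨m, hm⟩ : ∃ m : ℕ, c = -(m : ℤ) := ⟨(-c).toNat, by omega⟩
  have hmle : B0 + B1 + 2 ≤ m := by omega
  subst hm
  set K : ℝ := (1 / 2) ^ a0 * (1 / 2) ^ a1 / 4 ^ m with hK
  have hKpos : 0 < K := by positivity
  refine no_uniform_boxes hf (fun x hx => f5_nonneg a0 a1 _ _ _ hx)
    (fun j => box2 (1 - 2 * dy j) (1 - dy j) (1 - 2 * dy j) (1 - dy j))
    (fun j => measurableSet_box2 _ _ _ _)
    (fun j => box2_subset_ocube (by linarith [(dy_facts j).2.1]) (by linarith [(dy_facts j).1])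
      (by linarith [(dy_facts j).2.1]) (by linarith [(dy_facts j).1]))
    (fun j j' hjj' => Set.disjoint_left.mpr fun x hx hx' => dy_window_disjoint hjj' hx.1 hx'.1)
    (C := K) hKpos fun j => ?_
  obtain ⟨hδ, hδ4, hδ1⟩ := dy_facts j
  -- pointwise lower bound `L = (½)^{a₀+a₁} δ^{B₀} δ^{B₁} / (4δ)^m`
  set L : ℝ := (1 / 2) ^ a0 * (1 / 2) ^ a1 * (dy j ^ B0 * ((4 * dy j) ^ m)⁻¹ * dy j ^ B1) with hL
  have hlow : ∀ x ∈ box2 (1 - 2 * dy j) (1 - dy j) (1 - 2 * dy j) (1 - dy j),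
      L ≤ f5 a0 a1 B0 (-(m : ℤ)) B1 x := by
    intro x hx
    obtain ⟨⟨hx0, hx0'⟩, ⟨hx1, hx1'⟩⟩ := hx
    have e1 : (1 / 2 : ℝ) ^ a0 ≤ x 0 ^ a0 := pow_le_pow_left₀ (by norm_num) (by linarith) a0
    have e2 : (1 / 2 : ℝ) ^ a1 ≤ x 1 ^ a1 := pow_le_pow_left₀ (by norm_num) (by linarith) a1
    have e3 : dy j ^ B0 ≤ (1 - x 0) ^ (B0 : ℤ) := by
      rw [zpow_natCast]; exact pow_le_pow_left₀ hδ.le (by linarith) B0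
    have e5 : dy j ^ B1 ≤ (1 - x 1) ^ (B1 : ℤ) := by
      rw [zpow_natCast]; exact pow_le_pow_left₀ hδ.le (by linarith) B1
    have hu : 0 < 1 - x 0 * x 1 := by nlinarith
    have hu4 : 1 - x 0 * x 1 ≤ 4 * dy j := by nlinarith
    have e4 : ((4 * dy j) ^ m)⁻¹ ≤ (1 - x 0 * x 1) ^ (-(m : ℤ)) := by
      rw [zpow_neg, zpow_natCast]
      exact inv_anti₀ (pow_pos hu m) (pow_le_pow_left₀ hu.le hu4 m)
    calc L = (1 / 2) ^ a0 * (1 / 2) ^ a1 * (dy j ^ B0 * ((4 * dy j) ^ m)⁻¹ * dy j ^ B1) := hL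
      _ ≤ f5 a0 a1 B0 (-(m : ℤ)) B1 x := by
        unfold f5
        exact mul_le_mul (mul_le_mul e1 e2 (by positivity) (pow_nonneg (by linarith) _))
          (mul_le_mul (mul_le_mul e3 e4 (by positivity) (zpow_nonneg (by linarith) _)) e5
            (by positivity) (mul_nonneg (zpow_nonneg (by linarith) _) (zpow_nonneg hu.le _)))
          (by positivity) (mul_nonneg (pow_nonneg (by linarith) _) (pow_nonneg (by linarith) _))
  have hI := box_integral_ge hf (box2_subset_ocube (by linarith) (by linarith) (by linarith)
    (by linarith)) (by linarith) (by linarith) hlow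
  -- `L · δ² ≥ K`
  have hwin : (1 - dy j - (1 - 2 * dy j)) * (1 - dy j - (1 - 2 * dy j)) = dy j ^ 2 := by ring
  rw [hwin] at hI
  have hpow : dy j ^ m ≤ dy j ^ (B0 + B1 + 2) := pow_le_pow_of_le_one hδ.le hδ1 hmle
  have hkey : K ≤ L * dy j ^ 2 := by
    rw [hK, hL, mul_pow, mul_inv, div_eq_mul_inv]
    have h4 : (0 : ℝ) < 4 ^ m := by positivity
    have hdm : 0 < dy j ^ m := by positivity
    calc (1 / 2 : ℝ) ^ a0 * (1 / 2) ^ a1 * (4 ^ m)⁻¹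
        = (1 / 2) ^ a0 * (1 / 2) ^ a1 * (4 ^ m)⁻¹ * ((dy j ^ m)⁻¹ * dy j ^ m) := by
          rw [inv_mul_cancel₀ hdm.ne', mul_one]
      _ ≤ (1 / 2) ^ a0 * (1 / 2) ^ a1 * (4 ^ m)⁻¹ * ((dy j ^ m)⁻¹ * dy j ^ (B0 + B1 + 2)) := by
          gcongr
      _ = (1 / 2) ^ a0 * (1 / 2) ^ a1 * (dy j ^ B0 * ((4 ^ m)⁻¹ * (dy j ^ m)⁻¹) * dy j ^ B1) *
          dy j ^ 2 := by ring
  linarith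

/-- **Necessity of the convergence criterion for a `k = 2` atom with `q ≠ 0`.** -/
theorem necessity_two {q : ℚ} (hq : q ≠ 0) (a : Fin 2 → ℕ) (e : Fin 2 → Fin 2 → ℤ)
    (hI : IntegrableOn (atomQ 2 q a e) (ocube 2)) :
    0 ≤ e 0 0 ∧ 0 ≤ e 1 1 ∧ -(e 0 0 + e 1 1 + 1) ≤ e 0 1 := by
  have hf : IntegrableOn (f5 (a 0) (a 1) (e 0 0) (e 0 1) (e 1 1)) (ocube 2) := by
    refine IntegrableOn.congr_fun (hI.const_mul ((q : ℝ)⁻¹)) (fun x _ => ?_) (measurableSet_ocube 2)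
    have hq' : (q : ℝ) ≠ 0 := by exact_mod_cast hq
    rw [atomQ_two, ← mul_assoc, inv_mul_cancel₀ hq', one_mul, f5]
  have h0 := nec_b0 _ _ _ _ _ hf
  have h1 := nec_b1 _ _ _ _ _ hf
  exact ⟨h0, h1, nec_corner _ _ h0 h1 hf⟩

/-! ### `k = 2`: the stub -/

/-- **Case `k = 2` (the stub in dimension `2`).**  For `q ≠ 0` the convergence criterion forces
`e 0 0 = B₀ ≥ 0`, `e 1 1 = B₁ ≥ 0` and `e 0 1 ≥ −(B₀+B₁+1)`; if `e 0 1 = C ≥ 0` the atom is a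
multi-term 1b combination of `rep2 _ _ _ B₀ B₁ 0`, if `e 0 1 = −n` it IS `rep2 q a₀ a₁ B₀ B₁ n`;
in both cases `rep2_red` finishes. -/
theorem nested_two (q : ℚ) (a : Fin 2 → ℕ) (e : Fin 2 → Fin 2 → ℤ) (s : KZ.IntegralRep 2)
    (hdom : s.domain = ocube 2) (hint : EqOn s.integrand (atomQ 2 q a e) s.domain) :
    ∃ m ∈ Target 2, KZ.of s - m ∈ KZ.relations := by
  by_cases hq : q = 0
  · subst hq; exact goal_of_q_zero a e s hint
  have hI : IntegrableOn (atomQ 2 q a e) (ocube 2) :=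
    hdom ▸ s.integrableOn.congr_fun hint (KZ.IntegralRep.measurableSet_domain_holds s)
  obtain ⟨h00, h11, h01⟩ := necessity_two hq a e hI
  obtain ⟨B0, hB0⟩ := Int.eq_ofNat_of_zero_le h00
  obtain ⟨B1, hB1⟩ := Int.eq_ofNat_of_zero_le h11
  rcases le_or_gt 0 (e 0 1) with hc | hc
  · -- numerator kernel: polynomial times `(1 − x₀x₁)^C`
    obtain ⟨C, hC⟩ := Int.eq_ofNat_of_zero_le hc
    let R : ℕ → KZ.IntegralRep 2 := fun l => rep2 (q * bc C l) (a 0 + l) (a 1 + l) B0 B1 0 (by omega)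
    have hrel : KZ.of s - ∑ l ∈ Finset.range (C + 1), KZ.of (R l) ∈ KZ.relations := by
      refine KZ.of_sub_sum_integrand_mem_relations _ R s (fun l _ => by rw [hdom]; rfl) fun x hx => ?_
      rw [hint hx, atomQ_two, hB0, hB1, hC, zpow_natCast, zpow_natCast, zpow_natCast]
      exact numerator_kernel_expand q (a 0) (a 1) B0 B1 C x
    choose m hm hmrel using fun l : ℕ => rep2_red 0 (q * bc C l) (a 0 + l) (a 1 + l) B0 B1 (by omega)
    refine ⟨∑ l ∈ Finset.range (C + 1), m l, sum_mem fun l _ => hm l, ?_⟩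
    have h2 := KZ.relations.sum_mem (t := Finset.range (C + 1)) (fun l _ => hmrel l)
    have := add_mem hrel h2
    rwa [Finset.sum_sub_distrib, sub_add_sub_cancel] at this
  · -- denominator kernel of multiplicity `n`
    obtain ⟨n, hn⟩ : ∃ n : ℕ, e 0 1 = -(n : ℤ) := ⟨(-e 0 1).toNat, by omega⟩
    have hle : n ≤ B0 + B1 + 1 := by omega
    have hcongr : KZ.of s - KZ.of (rep2 q (a 0) (a 1) B0 B1 n hle) ∈ KZ.relations := by
      refine KZ.of_sub_of_mem_relations_of_eqOn (by rw [hdom]; rfl) fun x hx => ?_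
      rw [hdom] at hx
      obtain ⟨-, -, -, -, hu, -⟩ := two_facts hx
      rw [hint (hdom ▸ hx), atomQ_two, hB0, hB1, hn, zpow_natCast, zpow_natCast, zpow_neg,
        zpow_natCast, rep2_integrand, g2]
      field_simp
    obtain ⟨m, hm, hrel⟩ := rep2_red n q (a 0) (a 1) B0 B1 hle
    refine ⟨m, hm, ?_⟩
    have := add_mem hcongr hrel
    rwa [sub_add_sub_cancel] at this

end Nested

/-- **Registered sub-goal `stub_nestedReduction_le_two`**: the stub `stub_nestedReduction` in
dimension `k ≤ 2` (where every atom is nested): dispatch to `Nested.nested_zero`,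
`Nested.nested_one`, `Nested.nested_two`. -/
theorem stub_nestedReduction_le_two : ∀ (k : ℕ), k ≤ 2 → ∀ (q : ℚ) (a : Fin k → ℕ) (e : Fin k → Fin k → ℤ) (s : Literature.NumberTheory.Transcendental.KZ.IntegralRep k), s.domain = {x : Fin k → ℝ | ∀ i, x i ∈ Set.Ioo (0:ℝ) 1} → Set.EqOn s.integrand (fun x => (q : ℝ) * ((∏ i : Fin k, x i ^ a i) * ∏ i : Fin k, ∏ j : Fin k, if i ≤ j then (1 - (∏ l : Fin k, if i ≤ l ∧ l ≤ j then x l else 1)) ^ e i j else 1)) s.domain → (∀ i j i' j' : Fin k, i < j → i' < j' → e i j ≠ 0 → e i' j' ≠ 0 → (i ≤ i' ∧ j' ≤ j) ∨ (i' ≤ i ∧ j ≤ j')) → ∃ m ∈ AddSubgroup.closure ({z : Literature.NumberTheory.Transcendental.KZ.FormalRep | ∃ (q : ℚ) (ε : Fin k → Bool) (s : Literature.NumberTheory.Transcendental.KZ.IntegralRep k), s.domain = {x : Fin k → ℝ | ∀ i, x i ∈ Set.Ioo (0:ℝ) 1} ∧ Set.EqOn s.integrand (fun x => (q : ℝ)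 * ((∏ i : Fin k, x i ^ (k - 1 - (i : ℕ))) * ∏ i : Fin k, if ε i then 1 / (1 - (∏ l : Fin k, if l ≤ i then x l else 1)) else 1 / (∏ l : Fin k, if l ≤ i then x l else 1))) s.domain ∧ z = Literature.NumberTheory.Transcendental.KZ.of s} ∪ {z : Literature.NumberTheory.Transcendental.KZ.FormalRep | ∃ (q : ℚ) (a : Fin k → ℕ) (e : Fin k → Fin k → ℤ) (s : Literature.NumberTheory.Transcendental.KZ.IntegralRep k), (∃ lam : Fin k → ℤ, (∀ l : Fin k, lam l = 0 ∨ lam l = 1 ∨ lam l = -1) ∧ (∃ p : Fin k, lam p = -1) ∧ (Finset.univ.filter (fun l : Fin k => lam l = 1)).card ≤ 1 ∧ (∀ i j : Fin k, i ≤ j → e i j ≠ 0 → (∑ l : Fin k, if i ≤ l ∧ l ≤ j then lam l else 0) = 0) ∧ (∑ l : Fin k, lam l * ((a l : ℤ) + 1)) ≠ 0) ∧ s.domain = {x : Fin k → ℝ | ∀ i, x i ∈ Set.Ioo (0:ℝ) 1} ∧ Set.EqOn s.integrand (fun x => (q : ℝ) * ((∏ i : Fin k, x i ^ a i) * ∏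 i : Fin k, ∏ j : Fin k, if i ≤ j then (1 - (∏ l : Fin k, if i ≤ l ∧ l ≤ j then x l else 1)) ^ e i j else 1)) s.domain ∧ z = Literature.NumberTheory.Transcendental.KZ.of s} ∪ {z : Literature.NumberTheory.Transcendental.KZ.FormalRep | ∃ d : ℕ, d < k ∧ z ∈ {z : Literature.NumberTheory.Transcendental.KZ.FormalRep | ∃ (q : ℚ) (a : Fin d → ℕ) (e : Fin d → Fin d → ℤ) (s : Literature.NumberTheory.Transcendental.KZ.IntegralRep d), s.domain = {x : Fin d → ℝ | ∀ i, x i ∈ Set.Ioo (0:ℝ) 1} ∧ Set.EqOn s.integrand (fun x => (q : ℝ) * ((∏ i : Fin d, x i ^ a i) * ∏ i : Fin d, ∏ j : Fin d, if i ≤ j then (1 - (∏ l : Fin d, if i ≤ l ∧ l ≤ j then x l else 1)) ^ e i j else 1)) s.domain ∧ z = Literature.NumberTheory.Transcendental.KZ.of s}}), Literature.NumberTheory.Transcendental.KZ.of s - m ∈ Literature.NumberTheory.Transcendental.KZ.relations := by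
  intro k hk q a e s hdom hint _
  interval_cases k
  · exact Nested.nested_zero q a e s hdom hint
  · exact Nested.nested_one q a e s hdom hint
  · exact Nested.nested_two q a e s hdom hint

end Summit.KontsevichZagierPeriods.DihedralNormalForm.TorusDescent
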